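import Mathlib
import Summits.KontsevichZagierPeriods.Zeta5Search.Families.DualSpanProdCoeff
import HarnessLib

/-!
# ζ(5) search — Families: the coefficients of the dual span product, extraction order `g₅, g₀, g₄, g₁, g₃`

HONEST FRAMING: systematic search; no irrationality claim unless certified.  Exact identities between integers /
integer polynomials (seat P2 g8, Families layer); nothing about the arithmetic of ζ(5); no number of record moves.

Companion of `Families/DualConstantTermBinomial` (which draws the consequence: P2 g6's node
`LeadingCoeffIsDualCTBinom` — D-exact in BINOMIAL form — is a theorem).  P2 g6's 4-fold binomial sum `dualCTBinom`
(`Families/DualConstantTermInstances`) is the coefficient extraction of `[g^B] dualSpanProd A` in the order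
`g₅, g₀, g₄, g₁, g₃` (then `g₂` forced); cert-2 g7's closed form `DualCT.ctSum` (`Families/DualSpanProdCoeff`) used
a different order.  This file redoes cert-2's two steps in P2's order, with cert-2's generic extraction lemmas
(`DualCT.coeff_X_add_pow_mul`, `DualCT.coeff_X_pow_mul_X_add_pow_mul`, `DualCT.coeff_X_pow_single`) [folklore;
cf. McCarthy–Osburn–Straub 2020, §3.2, on ordered expansions of such constant terms]:
* `DualCTB.term`, **`DualCTB.dualSpanProd_eq_sum4`** — four binomial splits (`j ≤ A₁`, `i ≤ A₆`, `l ≤ A₁ − j`,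
  `r ≤ A₆ − i`);
* `DualCTB.termCoeff`, **`DualCTB.coeff_term`** — the chain of five extractions and the forced `g₂`-exponent.
Standard axioms only.
-/

noncomputable section

open MvPolynomial Finset

namespace Summit.KontsevichZagierPeriods.Zeta5Search.Families.Cellular

open Literature.NumberTheory.Irrationality
open Literature.NumberTheory.Irrationality.BrownZudilin2022 (zchoose)

namespace DualCTB

open DualCT

/-! ### STEP 1 — four binomial splits -/

/-- The summand of `dualSpanProd A` after the four binomial splits, arranged for the extraction order
`g₅, g₀, g₄, g₁, g₃`. -/
def term (A : Fin 8 → ℕ) (j i l r : ℕ) : P6 :=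
  X 5 ^ j * ((X 5 + (X 2 + X 3 + X 4)) ^ A 2 *
    (X 0 ^ i * ((X 0 + (X 1 + X 2)) ^ A 7 *
      ((X 2 + X 3 + X 4) ^ l * (X 1 ^ (A 1 - j - l) * ((X 1 + X 2) ^ r * (X 3 ^ (A 6 - i - r) *
        ((X 1 + X 2) ^ A 0 * (X 2 + X 3 + X 4) ^ A 3))))))))

/-- STEP 1: `dualSpanProd A = Σ_{j ≤ A₁} Σ_{i ≤ A₆} Σ_{l ≤ A₁−j} Σ_{r ≤ A₆−i} C(A₁,j)C(A₆,i)C(A₁−j,l)C(A₆−i,r) · term`. -/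
theorem dualSpanProd_eq_sum4 (A : Fin 8 → ℕ) :
    dualSpanProd A = ∑ j ∈ range (A 1 + 1), ∑ i ∈ range (A 6 + 1), ∑ l ∈ range (A 1 - j + 1),
      ∑ r ∈ range (A 6 - i + 1),
        C (((A 1).choose j : ℤ) * (A 6).choose i * (((A 1 - j).choose l : ℤ) * (A 6 - i).choose r)) *
          term A j i l r := by
  have h1 : (X 1 + X 2 + X 3 + X 4 + X 5 : P6) ^ A 1 =
      ∑ j ∈ range (A 1 + 1), X 5 ^ j * (X 1 + X 2 + X 3 + X 4) ^ (A 1 - j) * ((A 1).choose j : P6) := by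
    rw [show (X 1 + X 2 + X 3 + X 4 + X 5 : P6) = X 5 + (X 1 + X 2 + X 3 + X 4) by ring, add_pow]
  have h6 : (X 0 + X 1 + X 2 + X 3 : P6) ^ A 6 =
      ∑ i ∈ range (A 6 + 1), X 0 ^ i * (X 1 + X 2 + X 3) ^ (A 6 - i) * ((A 6).choose i : P6) := by
    rw [show (X 0 + X 1 + X 2 + X 3 : P6) = X 0 + (X 1 + X 2 + X 3) by ring, add_pow]
  have hl : ∀ n : ℕ, (X 1 + X 2 + X 3 + X 4 : P6) ^ n =
      ∑ l ∈ range (n + 1), (X 2 + X 3 + X 4) ^ l * X 1 ^ (n - l) * (n.choose l : P6) := by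
    intro n
    rw [show (X 1 + X 2 + X 3 + X 4 : P6) = (X 2 + X 3 + X 4) + X 1 by ring, add_pow]
  have hr : ∀ n : ℕ, (X 1 + X 2 + X 3 : P6) ^ n =
      ∑ r ∈ range (n + 1), (X 1 + X 2) ^ r * X 3 ^ (n - r) * (n.choose r : P6) := by
    intro n
    rw [show (X 1 + X 2 + X 3 : P6) = (X 1 + X 2) + X 3 by ring, add_pow]
  have hA2 : (X 2 + X 3 + X 4 + X 5 : P6) ^ A 2 = (X 5 + (X 2 + X 3 + X 4)) ^ A 2 := by
    rw [show (X 2 + X 3 + X 4 + X 5 : P6) = X 5 + (X 2 + X 3 + X 4) by ring]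
  have hA7 : (X 0 + X 1 + X 2 : P6) ^ A 7 = (X 0 + (X 1 + X 2)) ^ A 7 := by
    rw [show (X 0 + X 1 + X 2 : P6) = X 0 + (X 1 + X 2) by ring]
  unfold dualSpanProd
  rw [h1, h6, hA2, hA7]
  simp only [Finset.sum_mul, Finset.mul_sum]
  rw [Finset.sum_comm]
  refine Finset.sum_congr rfl fun j _ => Finset.sum_congr rfl fun i _ => ?_
  rw [hl (A 1 - j), hr (A 6 - i)]
  simp only [Finset.sum_mul, Finset.mul_sum]
  rw [Finset.sum_comm]
  refine Finset.sum_congr rfl fun l _ => Finset.sum_congr rfl fun r _ => ?_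
  unfold term
  simp only [← C_eq_coe_nat, map_mul]
  ring

/-! ### STEP 2 — the extraction chain `g₅, g₀, g₄, g₁, g₃`, then `g₂` -/

/-- The coefficient of `g^m` in `term A j i l r`: five binomial coefficients, four guards and the forced
`g₂`-exponent. -/
def termCoeff (A : Fin 8 → ℕ) (m : Fin 6 → ℕ) (j i l r : ℕ) : ℤ :=
  if j ≤ m 5 then
    ((A 2).choose (m 5 - j) : ℤ) *
      (if i ≤ m 0 then
        ((A 7).choose (m 0 - i) : ℤ) *
          ((((l + A 3 + (A 2 - (m 5 - j))).choose (m 4) : ℕ) : ℤ) *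
            (if A 1 - j - l ≤ m 1 then
              (((r + A 0 + (A 7 - (m 0 - i))).choose (m 1 - (A 1 - j - l)) : ℕ) : ℤ) *
                (if A 6 - i - r ≤ m 3 then
                  (((l + A 3 + (A 2 - (m 5 - j)) - m 4).choose (m 3 - (A 6 - i - r)) : ℕ) : ℤ) *
                    (if l + A 3 + (A 2 - (m 5 - j)) - m 4 - (m 3 - (A 6 - i - r)) +
                          (r + A 0 + (A 7 - (m 0 - i)) - (m 1 - (A 1 - j - l))) = m 2 then 1 else 0)
                else 0)
            else 0))
      else 0)
  else 0

/-- The multi-index left after erasing the slots `5,0,4,1,3` is `(m 2)·e₂`. -/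
theorem idx_eq (m : Fin 6 →₀ ℕ) :
    ((((m.erase 5).erase 0).erase 4).erase 1).erase 3 = Finsupp.single 2 (m 2) := by
  ext w
  fin_cases w <;> simp

/-- STEP 2: `[m] term A j i l r = termCoeff A m j i l r`. -/
theorem coeff_term (A : Fin 8 → ℕ) (j i l r : ℕ) (m : Fin 6 →₀ ℕ) :
    coeff m (term A j i l r) = termCoeff A m j i l r := by
  unfold term termCoeff
  rw [coeff_X_pow_mul_X_add_pow_mul (5 : Fin 6) ?_ ?_]
  rotate_left
  · repeat (first
      | with_reducible exact (notMem_vars_X_and (by decide)).1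
      | with_reducible apply notMem_vars_mul
      | with_reducible refine (notMem_vars_pow_and ?_ _).1
      | with_reducible apply notMem_vars_add)
  · repeat (first
      | with_reducible exact (notMem_vars_X_and (by decide)).1
      | with_reducible apply notMem_vars_mul
      | with_reducible refine (notMem_vars_pow_and ?_ _).1
      | with_reducible apply notMem_vars_add)
  by_cases h5 : j ≤ m 5
  swap
  · rw [if_neg h5, if_neg h5]
  rw [if_pos h5, if_pos h5]
  congr 1
  set n5 := A 2 - (m 5 - j) with hn5
  rw [show ((X 2 + X 3 + X 4) ^ n5 * (X 0 ^ i * ((X 0 + (X 1 + X 2)) ^ A 7 *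
      ((X 2 + X 3 + X 4) ^ l * (X 1 ^ (A 1 - j - l) * ((X 1 + X 2) ^ r * (X 3 ^ (A 6 - i - r) *
        ((X 1 + X 2) ^ A 0 * (X 2 + X 3 + X 4) ^ A 3))))))) : P6) =
      X 0 ^ i * ((X 0 + (X 1 + X 2)) ^ A 7 * ((X 2 + X 3 + X 4) ^ n5 *
      ((X 2 + X 3 + X 4) ^ l * (X 1 ^ (A 1 - j - l) * ((X 1 + X 2) ^ r * (X 3 ^ (A 6 - i - r) *
        ((X 1 + X 2) ^ A 0 * (X 2 + X 3 + X 4) ^ A 3))))))) by ring]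
  rw [coeff_X_pow_mul_X_add_pow_mul (0 : Fin 6) ?_ ?_]
  rotate_left
  · repeat (first
      | with_reducible exact (notMem_vars_X_and (by decide)).1
      | with_reducible apply notMem_vars_mul
      | with_reducible refine (notMem_vars_pow_and ?_ _).1
      | with_reducible apply notMem_vars_add)
  · repeat (first
      | with_reducible exact (notMem_vars_X_and (by decide)).1
      | with_reducible apply notMem_vars_mul
      | with_reducible refine (notMem_vars_pow_and ?_ _).1
      | with_reducible apply notMem_vars_add)
  have hm0 : (m.erase 5) 0 = m 0 := Finsupp.erase_ne (by decide)
  rw [hm0]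
  by_cases h0 : i ≤ m 0
  swap
  · rw [if_neg h0, if_neg h0]
  rw [if_pos h0, if_pos h0]
  congr 1
  set n0 := A 7 - (m 0 - i) with hn0
  rw [show ((X 1 + X 2) ^ n0 * ((X 2 + X 3 + X 4) ^ n5 *
      ((X 2 + X 3 + X 4) ^ l * (X 1 ^ (A 1 - j - l) * ((X 1 + X 2) ^ r * (X 3 ^ (A 6 - i - r) *
        ((X 1 + X 2) ^ A 0 * (X 2 + X 3 + X 4) ^ A 3)))))) : P6) =
      (X 4 + (X 2 + X 3)) ^ (l + A 3 + n5) *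
        (X 1 ^ (A 1 - j - l) * ((X 1 + X 2) ^ (r + A 0 + n0) * X 3 ^ (A 6 - i - r))) by ring]
  rw [coeff_X_add_pow_mul (4 : Fin 6) ?_ ?_]
  rotate_left
  · repeat (first
      | with_reducible exact (notMem_vars_X_and (by decide)).1
      | with_reducible apply notMem_vars_mul
      | with_reducible refine (notMem_vars_pow_and ?_ _).1
      | with_reducible apply notMem_vars_add)
  · repeat (first
      | with_reducible exact (notMem_vars_X_and (by decide)).1
      | with_reducible apply notMem_vars_mul
      | with_reducible refine (notMem_vars_pow_and ?_ _).1
      | with_reducible apply notMem_vars_add)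
  have hm4 : ((m.erase 5).erase 0) 4 = m 4 := by simp
  rw [hm4]
  congr 1
  rw [show ((X 2 + X 3) ^ (l + A 3 + n5 - m 4) *
      (X 1 ^ (A 1 - j - l) * ((X 1 + X 2) ^ (r + A 0 + n0) * X 3 ^ (A 6 - i - r))) : P6) =
      X 1 ^ (A 1 - j - l) * ((X 1 + X 2) ^ (r + A 0 + n0) *
        ((X 2 + X 3) ^ (l + A 3 + n5 - m 4) * X 3 ^ (A 6 - i - r))) by ring]
  rw [coeff_X_pow_mul_X_add_pow_mul (1 : Fin 6) ?_ ?_]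
  rotate_left
  · repeat (first
      | with_reducible exact (notMem_vars_X_and (by decide)).1
      | with_reducible apply notMem_vars_mul
      | with_reducible refine (notMem_vars_pow_and ?_ _).1
      | with_reducible apply notMem_vars_add)
  · repeat (first
      | with_reducible exact (notMem_vars_X_and (by decide)).1
      | with_reducible apply notMem_vars_mul
      | with_reducible refine (notMem_vars_pow_and ?_ _).1
      | with_reducible apply notMem_vars_add)
  have hm1 : (((m.erase 5).erase 0).erase 4) 1 = m 1 := by simp
  rw [hm1]
  by_cases h1 : A 1 - j - l ≤ m 1
  swap
  · rw [if_neg h1, if_neg h1]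
  rw [if_pos h1, if_pos h1]
  congr 1
  set n1 := r + A 0 + n0 - (m 1 - (A 1 - j - l)) with hn1
  rw [show (X 2 ^ n1 * ((X 2 + X 3) ^ (l + A 3 + n5 - m 4) * X 3 ^ (A 6 - i - r)) : P6) =
      X 3 ^ (A 6 - i - r) * ((X 3 + X 2) ^ (l + A 3 + n5 - m 4) * X 2 ^ n1) by ring]
  rw [coeff_X_pow_mul_X_add_pow_mul (3 : Fin 6) ?_ ?_]
  rotate_left
  · repeat (first
      | with_reducible exact (notMem_vars_X_and (by decide)).1
      | with_reducible apply notMem_vars_mul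
      | with_reducible refine (notMem_vars_pow_and ?_ _).1
      | with_reducible apply notMem_vars_add)
  · repeat (first
      | with_reducible exact (notMem_vars_X_and (by decide)).1
      | with_reducible apply notMem_vars_mul
      | with_reducible refine (notMem_vars_pow_and ?_ _).1
      | with_reducible apply notMem_vars_add)
  have hm3 : ((((m.erase 5).erase 0).erase 4).erase 1) 3 = m 3 := by simp
  rw [hm3]
  by_cases h3 : A 6 - i - r ≤ m 3
  swap
  · rw [if_neg h3, if_neg h3]
  rw [if_pos h3, if_pos h3]
  congr 1
  rw [idx_eq, ← pow_add, coeff_X_pow_single]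

end DualCTB

end Summit.KontsevichZagierPeriods.Zeta5Search.Families.Cellular
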